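import Summits.Parity.GeneralizedHardyLittlewood.Theorems.BeyondDiagonalBeatsQuarter.MellinBump
import HarnessLib

/-!
# C1-R1 (ls-ref-1 g17, candidate for ls-Bfam-prover-1 to land): the Mellin-bump lemma RE-PACKAGED K-FREE

Same proof as `MellinBump.mellinBump_xsq` (p629046), with the sup norm `|h| ≤ B` kept as a separate
hypothesis and the sampling-step term kept honest (`m₁/Y`, summed over the passive variable `m₁ ≤ √(bY)`,
gives `√(bY)/Y = √(b/Y)`), so that the constant is
`D · ((2B + K(b − a))·(1 + |log b|) + 2K·√(bY)/Y)`, with `D = D(k, a₀)` for all windows `[a, b]`, `a ≥ a₀`: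
the term `K(b − a)` is SCALE-INVARIANT (= 2·sup for a tent of any width) and `K√(b/Y)` is the aliasing
loss, `≍ 1/(w√Y)` for a bump of relative width `w` — so a family of NARROW bumps (width `w → 0`, `K ≍ 1/w`)
at scales `Y` with `w√Y ≫ 1` is served with the same `(1 + log Y)^{-k}` saving and NO short-interval Möbius
input. (This is an ABSOLUTE saving per window; a MASS-PROPORTIONAL saving `w·L^{-A}` is a different
statement — see ls-ref-1 g17 W3 read, evidence stmt-Parity-20343 #51.) Helper; closes nothing; theorems only.
«The programme SEARCHES and TYPES; no claim about Landau–Siegel zeros, Theorems 1–2 of arXiv:2211.02515 or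
a repaired Margin232 until a kernel theorem says so.»
-/

noncomputable section

open scoped Real ArithmeticFunction.Moebius
open Finset ArithmeticFunction

namespace Summit.Parity.GeneralizedHardyLittlewood.Theorems.BeyondDiagonalBeatsQuarter.MellinBump

open Literature.NumberTheory.LFunctions Literature.NumberTheory.LFunctions.KMV2000
open MollifierMainTerm (W)
open KernelFormXSq

/-- **The inner sum after Abel summation, sup-norm form.** As `abs_inner_le`, but with `|h| ≤ B` a
hypothesis and the step term `2K·(m₁/Y)` kept:
`|Σ_{u < m₂ ≤ ⌊M⌋} W(m₂)·λ_M(m₂)·h(m₁m₂/Y)| ≤ η·(2B + K(b − a) + 2K·m₁/Y)`. [folklore] -/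
theorem abs_inner_le_bv {h : ℝ → ℝ} {a b K B : ℝ} (ha : 0 < a) (hab : a ≤ b) (hK : 0 ≤ K)
    (hLip : ∀ x y, |h x - h y| ≤ K * |x - y|) (hsupp : ∀ y, h y ≠ 0 → a ≤ y ∧ y ≤ b)
    (hBh : ∀ y, |h y| ≤ B)
    {M Y η : ℝ} (hM : 1 < M) (hY : 1 ≤ Y) (hη : 0 ≤ η)
    (hA : ∀ e : ℕ, Real.sqrt (a * Y) - 1 ≤ (e : ℝ) → |∑ j ∈ Icc 1 e, W j| ≤ η)
    {m₁ u : ℕ} (hm₁ : 1 ≤ m₁) (hu : m₁ ≤ u + 1) (huN : u ≤ ⌊M⌋₊) :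
    |∑ m₂ ∈ Ioc u ⌊M⌋₊, W m₂ * (logWeight M m₂ * h ((m₁ : ℝ) / Y * m₂))| ≤
      η * (2 * B + (K * (b - a) + 2 * K * ((m₁ : ℝ) / Y))) := by
  have hY0 : 0 < Y := by linarith
  have hm0 : (0 : ℝ) < m₁ := by exact_mod_cast hm₁
  have hc0 : 0 < (m₁ : ℝ) / Y := by positivity
  have hB0 : 0 ≤ B := (abs_nonneg _).trans (hBh 0)
  -- where the weight moves, the partial sums are small
  have hmove : ∀ e, u ≤ e → e ≤ ⌊M⌋₊ →
      ((fun e : ℕ ↦ logWeight M e * h ((m₁ : ℝ) / Y * e)) e ≠ 0 ∨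
        (fun e : ℕ ↦ logWeight M e * h ((m₁ : ℝ) / Y * e)) (e + 1) ≠ 0) →
      |∑ j ∈ Icc 1 e, (fun j : ℕ ↦ W j) j| ≤ η := by
    intro e hue _ hmv
    apply hA
    have hex : a * Y / m₁ ≤ (e : ℝ) + 1 := by
      rcases hmv with h1 | h1
      · have hh : h ((m₁ : ℝ) / Y * e) ≠ 0 := fun h0 ↦ h1 (by simp only [h0, mul_zero])
        have h2 := (hsupp _ hh).1
        rw [show (m₁ : ℝ) / Y * e = (m₁ : ℝ) * e / Y by ring, le_div_iff₀ hY0] at h2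
        rw [div_le_iff₀ hm0]
        nlinarith
      · have hh : h ((m₁ : ℝ) / Y * ((e + 1 : ℕ) : ℝ)) ≠ 0 := fun h0 ↦ h1 (by simp only [h0, mul_zero])
        have h2 := (hsupp _ hh).1
        push_cast at h2
        rw [show (m₁ : ℝ) / Y * ((e : ℝ) + 1) = (m₁ : ℝ) * ((e : ℝ) + 1) / Y by ring,
          le_div_iff₀ hY0] at h2
        rw [div_le_iff₀ hm0]
        linarith
    have hm : (m₁ : ℝ) ≤ (e : ℝ) + 1 := by exact_mod_cast (by omega : m₁ ≤ e + 1)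
    have hprod : a * Y ≤ ((e : ℝ) + 1) ^ 2 := by
      have e1 : (m₁ : ℝ) * (a * Y / m₁) = a * Y := by field_simp
      calc a * Y = (m₁ : ℝ) * (a * Y / m₁) := e1.symm
        _ ≤ ((e : ℝ) + 1) * ((e : ℝ) + 1) := mul_le_mul hm hex (by positivity) (by positivity)
        _ = ((e : ℝ) + 1) ^ 2 := by ring
    have : Real.sqrt (a * Y) ≤ (e : ℝ) + 1 := by
      rw [← Real.sqrt_sq (by positivity : (0 : ℝ) ≤ (e : ℝ) + 1)]
      exact Real.sqrt_le_sqrt hprod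
    linarith
  have hφN : (fun e : ℕ ↦ logWeight M e * h ((m₁ : ℝ) / Y * e)) (⌊M⌋₊ + 1) = 0 := by
    simp only [logWeight_of_lt (Nat.lt_succ_self _), zero_mul]
  have habel := abs_sum_mul_le_of_tv (fun j : ℕ ↦ W j)
    (fun e : ℕ ↦ logWeight M e * h ((m₁ : ℝ) / Y * e)) huN hmove hφN
  -- total variation of the weight
  have hTVl : ∑ e ∈ Ioc u ⌊M⌋₊, |logWeight M e - logWeight M (e + 1)| ≤ logWeight M (u + 1) :=
    tv_antitone_le _ huN (logWeight_nonneg M) (fun e hue ↦ logWeight_succ_le hM (by omega))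
  have hTVg : ∑ e ∈ Ioc u ⌊M⌋₊, |h ((m₁ : ℝ) / Y * e) - h ((m₁ : ℝ) / Y * (e + 1))| ≤
      K * (b - a) + 2 * K * ((m₁ : ℝ) / Y) := tv_comp_mul_le ha hab hK hc0 hLip hsupp _
  have h1 := tv_mul_le (logWeight M) (fun e : ℕ ↦ h ((m₁ : ℝ) / Y * e)) (Ioc u ⌊M⌋₊)
    (abs_logWeight_le_one hM) (fun n ↦ hBh _)
  push_cast at h1 habel
  have hlu : logWeight M (u + 1) ≤ 1 := logWeight_le_one hM (by omega)
  have hφu : |logWeight M (u + 1) * h ((m₁ : ℝ) / Y * ((u : ℝ) + 1))| ≤ B := by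
    rw [abs_mul]
    calc |logWeight M (u + 1)| * |h ((m₁ : ℝ) / Y * ((u : ℝ) + 1))| ≤ 1 * B :=
          mul_le_mul (abs_logWeight_le_one hM _) (hBh _) (abs_nonneg _) zero_le_one
      _ = B := one_mul _
  have hTV : ∑ e ∈ Ioc u ⌊M⌋₊, |logWeight M e * h ((m₁ : ℝ) / Y * e) -
      logWeight M (e + 1) * h ((m₁ : ℝ) / Y * ((e : ℝ) + 1))| ≤
      B + (K * (b - a) + 2 * K * ((m₁ : ℝ) / Y)) := by
    refine h1.trans ?_
    have hA' : B * ∑ e ∈ Ioc u ⌊M⌋₊, |logWeight M e - logWeight M (e + 1)| ≤ B * 1 :=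
      mul_le_mul_of_nonneg_left (hTVl.trans hlu) hB0
    linarith
  calc |∑ m₂ ∈ Ioc u ⌊M⌋₊, W m₂ * (logWeight M m₂ * h ((m₁ : ℝ) / Y * m₂))|
      ≤ η * (∑ e ∈ Ioc u ⌊M⌋₊, |logWeight M e * h ((m₁ : ℝ) / Y * e) -
          logWeight M (e + 1) * h ((m₁ : ℝ) / Y * ((e : ℝ) + 1))| +
          |logWeight M (u + 1) * h ((m₁ : ℝ) / Y * ((u : ℝ) + 1))|) := habel
    _ ≤ η * (B + (K * (b - a) + 2 * K * ((m₁ : ℝ) / Y)) + B) := by gcongr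
    _ = η * (2 * B + (K * (b - a) + 2 * K * ((m₁ : ℝ) / Y))) := by ring

/-- `#{m ∈ [1, N] : m ≤ X} ≤ X` for `X > 0`. [folklore] -/
theorem sum_indicator_le_self {X : ℝ} (hX : 0 < X) (N : ℕ) :
    ∑ m ∈ Icc 1 N, (if (m : ℝ) ≤ X then (1 : ℝ) else 0) ≤ X := by
  rw [← Finset.sum_filter, Finset.sum_const, nsmul_eq_mul, mul_one]
  have hsub : (Icc 1 N).filter (fun m : ℕ ↦ (m : ℝ) ≤ X) ⊆ Icc 1 ⌊X⌋₊ := by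
    intro m hm
    rw [Finset.mem_filter, Finset.mem_Icc] at hm
    rw [Finset.mem_Icc]
    exact ⟨hm.1.1, Nat.le_floor hm.2⟩
  calc (((Icc 1 N).filter (fun m : ℕ ↦ (m : ℝ) ≤ X)).card : ℝ) ≤ ((Icc 1 ⌊X⌋₊).card : ℝ) := by
        exact_mod_cast Finset.card_le_card hsub
    _ = ⌊X⌋₊ := by rw [Nat.card_Icc, Nat.add_sub_cancel]
    _ ≤ X := Nat.floor_le hX.le

/-- **C1-R1 — the Mellin-bump lemma, K-free packaging.** For every `k : ℕ` and every `a₀ > 0` there is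
`D > 0` such that for all windows `a₀ ≤ a ≤ b`, all `K ≥ 0`, every `K`-Lipschitz `h` supported in `[a, b]`
with `|h| ≤ B`, every `M > 1` and every `Y ≥ 1`,
`|Σ_{m₁,m₂ ≤ M} (x_{m₁}/m₁)(x_{m₂}/m₂) h(m₁m₂/Y)| ≤ D·((2B + K(b − a))(1 + |log b|) + 2K·√(bY)/Y)/(1 + log Y)^k`.
The constant of `mellinBump_xsq` is the special case `B = Kb`, `√(bY)/Y ≤ b + 1`. [folklore] -/
theorem mellinBump_xsq_bv (k : ℕ) {a₀ : ℝ} (ha₀ : 0 < a₀) :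
    ∃ D : ℝ, 0 < D ∧ ∀ a b K B : ℝ, a₀ ≤ a → a ≤ b → 0 ≤ K →
      ∀ h : ℝ → ℝ, (∀ x y, |h x - h y| ≤ K * |x - y|) →
      (∀ y, h y ≠ 0 → a ≤ y ∧ y ≤ b) → (∀ y, |h y| ≤ B) → ∀ M : ℝ, 1 < M → ∀ Y : ℝ, 1 ≤ Y →
        |∑ m₁ ∈ Icc 1 ⌊M⌋₊, ∑ m₂ ∈ Icc 1 ⌊M⌋₊,
            xsq M m₁ / m₁ * (xsq M m₂ / m₂) * h ((m₁ : ℝ) * m₂ / Y)| ≤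
          D * ((2 * B + K * (b - a)) * (1 + |Real.log b|) + 2 * K * (Real.sqrt (b * Y) / Y)) /
            (1 + Real.log Y) ^ k := by
  obtain ⟨D, hD, hDb⟩ := abs_sum_W_le_threshold (k + 1) ha₀
  refine ⟨2 * D, by positivity, fun a b K B ha₀a hab hK h hLip hsupp hBh M hM Y hY ↦ ?_⟩
  have ha : 0 < a := lt_of_lt_of_le ha₀ ha₀a
  have hb : 0 < b := by linarith
  have hB0 : 0 ≤ B := (abs_nonneg _).trans (hBh 0)
  set N := ⌊M⌋₊ with hN
  have hY0 : 0 < Y := by linarith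
  have hLY : 0 ≤ Real.log Y := Real.log_nonneg hY
  set L : ℝ := 1 + Real.log Y with hL
  have hL1 : 1 ≤ L := by rw [hL]; linarith
  set η : ℝ := D / L ^ (k + 1) with hη
  have hη0 : 0 ≤ η := by positivity
  have hA : ∀ e : ℕ, Real.sqrt (a * Y) - 1 ≤ (e : ℝ) → |∑ j ∈ Icc 1 e, W j| ≤ η := by
    intro e he
    refine hDb Y hY e ?_
    have : Real.sqrt (a₀ * Y) ≤ Real.sqrt (a * Y) :=
      Real.sqrt_le_sqrt (mul_le_mul_of_nonneg_right ha₀a hY0.le)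
    linarith
  -- symmetrise
  have hsym : ∀ x y : ℕ, xsq M x / x * (xsq M y / y) * h ((x : ℝ) * y / Y) =
      xsq M y / y * (xsq M x / x) * h ((y : ℝ) * x / Y) := by
    intro x y; rw [mul_comm (xsq M x / x), mul_comm (x : ℝ)]
  rw [sum_sum_eq_sum_upper _ hsym]
  -- inner sums in `W·λ` form
  have hinner : ∀ m₁ ∈ Icc 1 N, ∀ u, m₁ ≤ u + 1 →
      ∑ m₂ ∈ Ioc u N, xsq M m₁ / m₁ * (xsq M m₂ / m₂) * h ((m₁ : ℝ) * m₂ / Y) =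
        xsq M m₁ / m₁ * ∑ m₂ ∈ Ioc u N, W m₂ * (logWeight M m₂ * h ((m₁ : ℝ) / Y * m₂)) := by
    intro m₁ hm₁ u hu
    rw [Finset.mul_sum]
    refine Finset.sum_congr rfl fun m₂ hm₂ ↦ ?_
    rw [Finset.mem_Ioc] at hm₂
    rw [xsq_div_eq (m := m₂) (by omega) hm₂.2, show (m₁ : ℝ) * m₂ / Y = (m₁ : ℝ) / Y * m₂ by ring]
    ring
  -- the two constants
  set c₁ : ℝ := 2 * η * (2 * B + K * (b - a)) with hc₁
  set c₂ : ℝ := 4 * η * K / Y with hc₂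
  have hKba : 0 ≤ K * (b - a) := mul_nonneg hK (by linarith)
  have hc₁0 : 0 ≤ c₁ := by positivity
  have hc₂0 : 0 ≤ c₂ := by positivity
  -- bound per m₁
  have hX : 0 < Real.sqrt (b * Y) := Real.sqrt_pos.2 (by positivity)
  have hper : ∀ m₁ ∈ Icc 1 N,
      |∑ m₂ ∈ Ioc (m₁ - 1) N, xsq M m₁ / m₁ * (xsq M m₂ / m₂) * h ((m₁ : ℝ) * m₂ / Y) +
        ∑ m₂ ∈ Ioc m₁ N, xsq M m₁ / m₁ * (xsq M m₂ / m₂) * h ((m₁ : ℝ) * m₂ / Y)| ≤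
      (if (m₁ : ℝ) ≤ Real.sqrt (b * Y) then (m₁ : ℝ)⁻¹ else 0) * c₁ +
        (if (m₁ : ℝ) ≤ Real.sqrt (b * Y) then (1 : ℝ) else 0) * c₂ := by
    intro m₁ hm₁
    have hm₁' := Finset.mem_Icc.1 hm₁
    have hm0 : (0 : ℝ) < m₁ := by exact_mod_cast hm₁'.1
    rw [hinner m₁ hm₁ (m₁ - 1) (by omega), hinner m₁ hm₁ m₁ (by omega), ← mul_add, abs_mul]
    split_ifs with hP
    · -- m₁ ≤ √(bY): Abel bound for both inner sums
      have hI₁ := abs_inner_le_bv ha hab hK hLip hsupp hBh hM hY hη0 hA hm₁'.1 (u := m₁ - 1)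
        (by omega) (by omega)
      have hI₂ := abs_inner_le_bv ha hab hK hLip hsupp hBh hM hY hη0 hA hm₁'.1 (u := m₁) (by omega)
        hm₁'.2
      have hw : |xsq M m₁ / m₁| ≤ (m₁ : ℝ)⁻¹ := abs_xsq_div_le hM hm₁'.1 hm₁'.2
      have hsum2 : 0 ≤ η * (2 * B + (K * (b - a) + 2 * K * ((m₁ : ℝ) / Y))) := by positivity
      calc |xsq M m₁ / m₁| * |∑ m₂ ∈ Ioc (m₁ - 1) N, W m₂ * (logWeight M m₂ * h ((m₁ : ℝ) / Y * m₂)) +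
            ∑ m₂ ∈ Ioc m₁ N, W m₂ * (logWeight M m₂ * h ((m₁ : ℝ) / Y * m₂))|
          ≤ (m₁ : ℝ)⁻¹ * (η * (2 * B + (K * (b - a) + 2 * K * ((m₁ : ℝ) / Y))) +
              η * (2 * B + (K * (b - a) + 2 * K * ((m₁ : ℝ) / Y)))) :=
            mul_le_mul hw ((abs_add_le _ _).trans (add_le_add hI₁ hI₂)) (abs_nonneg _) (by positivity)
        _ = (m₁ : ℝ)⁻¹ * c₁ + 1 * c₂ := by
            rw [hc₁, hc₂]; field_simp; ring
    · -- m₁ > √(bY): every term vanishes (m₂ ≥ m₁ forces m₁m₂ > bY)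
      push Not at hP
      have hbY : b * Y < (m₁ : ℝ) ^ 2 := by
        have h1 : Real.sqrt (b * Y) ^ 2 = b * Y := Real.sq_sqrt (by positivity)
        nlinarith [Real.sqrt_nonneg (b * Y)]
      have hzero : ∀ u, m₁ ≤ u + 1 →
          ∑ m₂ ∈ Ioc u N, W m₂ * (logWeight M m₂ * h ((m₁ : ℝ) / Y * m₂)) = 0 := by
        intro u hu
        refine Finset.sum_eq_zero fun m₂ hm₂ ↦ ?_
        rw [Finset.mem_Ioc] at hm₂
        have hm₂' : (m₁ : ℝ) ≤ m₂ := by exact_mod_cast (by omega : m₁ ≤ m₂)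
        have hh : h ((m₁ : ℝ) / Y * m₂) = 0 := by
          by_contra hne
          have := (hsupp _ hne).2
          rw [div_mul_eq_mul_div, div_le_iff₀ hY0] at this
          nlinarith
        rw [hh, mul_zero, mul_zero]
      rw [hzero (m₁ - 1) (by omega), hzero m₁ (by omega), add_zero, abs_zero, mul_zero, zero_mul,
        zero_mul, add_zero]
  -- sums over m₁
  have hsum_inv : ∑ m₁ ∈ Icc 1 N, (if (m₁ : ℝ) ≤ Real.sqrt (b * Y) then (m₁ : ℝ)⁻¹ else 0) ≤
      (1 + |Real.log b|) * L := by
    rw [← Finset.sum_filter]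
    refine (sum_inv_filter_le hX N).trans ?_
    have h1 : Real.log (Real.sqrt (b * Y)) = (Real.log b + Real.log Y) / 2 := by
      rw [Real.log_sqrt (by positivity), Real.log_mul hb.ne' hY0.ne']
    rw [h1, hL]
    have h2 : |(Real.log b + Real.log Y) / 2| ≤ (|Real.log b| + Real.log Y) / 2 := by
      rw [abs_div, abs_of_pos (by norm_num : (0 : ℝ) < 2)]
      gcongr
      exact (abs_add_le _ _).trans (by rw [abs_of_nonneg hLY])
    nlinarith [abs_nonneg (Real.log b)]
  have hsum_one : ∑ m₁ ∈ Icc 1 N, (if (m₁ : ℝ) ≤ Real.sqrt (b * Y) then (1 : ℝ) else 0) ≤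
      Real.sqrt (b * Y) := sum_indicator_le_self hX N
  have hLk : 0 < L ^ k := by positivity
  have hLk1 : 0 < L ^ (k + 1) := by positivity
  have hlogb : 0 ≤ 1 + |Real.log b| := by positivity
  have hL0 : L ≠ 0 := by positivity
  have hT1 : (1 + |Real.log b|) * L * c₁ =
      2 * D * ((2 * B + K * (b - a)) * (1 + |Real.log b|)) / L ^ k := by
    rw [hc₁, hη, pow_succ]
    field_simp
  have hT2 : Real.sqrt (b * Y) * c₂ = 2 * D * (2 * K * (Real.sqrt (b * Y) / Y)) / L ^ (k + 1) := by
    rw [hc₂, hη]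
    field_simp
    ring
  calc |∑ m₁ ∈ Icc 1 N, (∑ m₂ ∈ Ioc (m₁ - 1) N, xsq M m₁ / m₁ * (xsq M m₂ / m₂) * h ((m₁ : ℝ) * m₂ / Y) +
          ∑ m₂ ∈ Ioc m₁ N, xsq M m₁ / m₁ * (xsq M m₂ / m₂) * h ((m₁ : ℝ) * m₂ / Y))|
      ≤ ∑ m₁ ∈ Icc 1 N, |∑ m₂ ∈ Ioc (m₁ - 1) N, xsq M m₁ / m₁ * (xsq M m₂ / m₂) * h ((m₁ : ℝ) * m₂ / Y) +
          ∑ m₂ ∈ Ioc m₁ N, xsq M m₁ / m₁ * (xsq M m₂ / m₂) * h ((m₁ : ℝ) * m₂ / Y)| :=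
        Finset.abs_sum_le_sum_abs _ _
    _ ≤ ∑ m₁ ∈ Icc 1 N, ((if (m₁ : ℝ) ≤ Real.sqrt (b * Y) then (m₁ : ℝ)⁻¹ else 0) * c₁ +
          (if (m₁ : ℝ) ≤ Real.sqrt (b * Y) then (1 : ℝ) else 0) * c₂) := Finset.sum_le_sum hper
    _ = (∑ m₁ ∈ Icc 1 N, (if (m₁ : ℝ) ≤ Real.sqrt (b * Y) then (m₁ : ℝ)⁻¹ else 0)) * c₁ +
          (∑ m₁ ∈ Icc 1 N, (if (m₁ : ℝ) ≤ Real.sqrt (b * Y) then (1 : ℝ) else 0)) * c₂ := by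
        rw [Finset.sum_add_distrib, Finset.sum_mul, Finset.sum_mul]
    _ ≤ (1 + |Real.log b|) * L * c₁ + Real.sqrt (b * Y) * c₂ := by gcongr
    _ = 2 * D * ((2 * B + K * (b - a)) * (1 + |Real.log b|)) / L ^ k +
          2 * D * (2 * K * (Real.sqrt (b * Y) / Y)) / L ^ (k + 1) := by rw [hT1, hT2]
    _ ≤ 2 * D * ((2 * B + K * (b - a)) * (1 + |Real.log b|)) / L ^ k +
          2 * D * (2 * K * (Real.sqrt (b * Y) / Y)) / L ^ k := by
        have hnum : 0 ≤ 2 * D * (2 * K * (Real.sqrt (b * Y) / Y)) := by positivity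
        have hmono : 2 * D * (2 * K * (Real.sqrt (b * Y) / Y)) / L ^ (k + 1) ≤
            2 * D * (2 * K * (Real.sqrt (b * Y) / Y)) / L ^ k :=
          div_le_div_of_nonneg_left hnum hLk (pow_le_pow_right₀ hL1 (by omega))
        linarith
    _ = 2 * D * ((2 * B + K * (b - a)) * (1 + |Real.log b|) + 2 * K * (Real.sqrt (b * Y) / Y)) /
          L ^ k := by ring

end Summit.Parity.GeneralizedHardyLittlewood.Theorems.BeyondDiagonalBeatsQuarter.MellinBump
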